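import Summits.RiemannHypothesis.RiemannHypothesis.Theorems.SuzukiStructureFunctionsMuContinuity
import Summits.RiemannHypothesis.RiemannHypothesis.Theorems.SuzukiStructureFunctionsParity

/-!
# SuzukiStructureFunctionsStructContinuity — Thm. 3.1 (2) of Suzuki JFA21, second part: `A(t,z)`, `B(t,z)`, `E(t,z)`
# are continuous in `t` on every clean range `[0,τ)`; with `…MuContinuity` this DISCHARGES the continuity half of the
# declared residual `Suzuki2021_thm31_dynamics` (column DBR; RH-FREE)

LINE 1 — LABEL: RH-FREE (ζ-free analysis for ANY Suzuki pair `(ϱ, K)` on its clean ranges; no zeros, no positivity);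
bears_on LADDER-RH B-D → B-P(P1): `thm31_continuity` = the first two conjuncts of
`Literature.NumberTheory.LFunctions.SuzukiStructure.Suzuki2021_thm31_dynamics` under a Suzuki pair and (K5) on `[0,τ)`
(the printed (K1) `ϱ ∈ C¹` and (K4) are not needed for continuity). WHAT THIS IS NOT: not progress toward RH; the
piecewise-`C¹` clause and the canonical system (Thm. 3.1 (4)) remain open in the tree.

Source: M. Suzuki, J. Funct. Anal. 281 (2021) 109116 = arXiv:1606.05726 [Suzuki2021Hamiltonians], Thm. 3.1 (2),
Lemma 3.6, Prop. 3.1–3.2.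

Contents (seat rh-dbr-eng-5 g7): `norm_toLp_indicator_window_le`; **`exists_bound_suzukiPhiExt_window`** (uniform bound
`|φ^ε(t,y)| ≤ M` on the windows of a compact clean range — resolvent formula + Cauchy–Schwarz);
**`frakFG_decay_uniform`** (Prop. 3.1's decay with `t`-uniform constant); `continuousOn_window_integral`,
`continuousOn_frakFG` (dominated convergence in `y`); `continuousOn_fourier_frakFG` (dominated convergence in `x`);
**`continuousOn_structA`, `continuousOn_structB`, `continuousOn_structE`** (continuity in `t` on `[0,τ)`);
**`thm31_continuity`** (the package).
-/

noncomputable section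

-- D-0017: `Summit.<S>.<S>.…` is the designed namespace of a single-problem summit.
set_option linter.dupNamespace false

open MeasureTheory Set Filter Topology Function Complex
open scoped ENNReal RealInnerProductSpace

namespace Summit.RiemannHypothesis.RiemannHypothesis.Theorems.SuzukiStructureFunctions

open Literature.Analysis.OperatorTheory Literature.NumberTheory.LFunctions
  Literature.NumberTheory.LFunctions.SuzukiStructure
open Summit.RiemannHypothesis.RiemannHypothesis.Theorems.SuzukiPhiExistence
  (continuous_suzukiPhiExt exists_isSuzukiPhiSolution_of_noUnitEigenvalue)

variable {ϱ K : ℝ → ℝ} {ε t : ℝ}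

/-! ## §18 Thm. 3.1 (2), second part: `A(t,z)`, `B(t,z)`, `E(t,z)` are continuous in `t` on clean ranges

With §17's resolvent formula, `φ^ε(t,y)` is bounded on the windows `|y| ≤ t ≤ T` uniformly on a compact clean range,
so the decay `|𝔉(t,x)| ≪_n e^{−n|x|}` of Prop. 3.1 is uniform in `t ∈ [0,T]`; two dominated-convergence steps
(`y`-integral in (3.28), `x`-integral in (3.27)) give the continuity of `t ↦ 𝔄(t,z)`, and `A = m𝔄`, `B = m⁻¹𝔅`. -/

/-- RH-FREE. The `L²(ℝ)`-norm of a window row: `‖𝟙_{[−t,t]}K(y+·)‖ ≤ C_T √(2T)`... in squared form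
`‖𝟙_{[−t,t]}G(t,·)‖² ≤ D² · vol[−t,t]` whenever `|G(t,u)| ≤ D` on the window. -/
theorem norm_toLp_indicator_window_le {G : ℝ → ℝ → ℝ} (hG : Continuous (uncurry G)) {t D : ℝ} (ht : 0 ≤ t)
    (hD : 0 ≤ D) (hle : ∀ u : ℝ, u ∈ Icc (-t) t → |G t u| ≤ D) :
    ‖(memLp_indicator_window hG t).toLp _‖ ≤ D * Real.sqrt (2 * t) := by
  have hsq : ‖(memLp_indicator_window hG t).toLp _‖ ^ 2 ≤ (D * Real.sqrt (2 * t)) ^ 2 := by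
    rw [norm_toLp_sq_eq_integral_norm_sq (memLp_indicator_window hG t), mul_pow, Real.sq_sqrt (by linarith)]
    have e : (fun u : ℝ => ‖(Icc (-t) t).indicator (fun u => G t u) u‖ ^ 2) =
        (Icc (-t) t).indicator (fun u => |G t u| ^ 2) := by
      funext u
      by_cases hu : u ∈ Icc (-t) t
      · rw [indicator_of_mem hu, indicator_of_mem hu, Real.norm_eq_abs]
      · rw [indicator_of_notMem hu, indicator_of_notMem hu]; simp
    rw [e, integral_indicator measurableSet_Icc]
    have hb := norm_setIntegral_le_of_norm_le_const (show (volume : Measure ℝ) (Icc (-t) t) < ∞ from measure_Icc_lt_top)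
      (f := fun u : ℝ => |G t u| ^ 2) (C := D ^ 2) (fun u hu => by
        rw [Real.norm_eq_abs, abs_pow, abs_abs]; exact pow_le_pow_left₀ (abs_nonneg _) (hle u hu) 2)
    rw [Real.norm_eq_abs, abs_of_nonneg (integral_nonneg fun u => sq_nonneg _),
      Real.volume_real_Icc_of_le (by linarith)] at hb
    calc ∫ u in Icc (-t) t, |G t u| ^ 2 ≤ D ^ 2 * (t - -t) := hb
      _ = D ^ 2 * (2 * t) := by ring
  exact (pow_le_pow_iff_left₀ (norm_nonneg _) (by positivity) two_ne_zero).1 hsq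

/-- **RH-FREE · UNIFORM WINDOW BOUND:** on a compact clean range (`NoUnitEigenvalue K t` for all `0 ≤ t ≤ T`), Suzuki's
solutions are uniformly bounded on their windows: `|φ^ε(t,y)| ≤ M` for all `0 ≤ t ≤ T`, `|y| ≤ t` (resolvent formula +
Cauchy–Schwarz + continuity of the resolvent on the compact range). -/
theorem exists_bound_suzukiPhiExt_window (hK : Continuous K) (hK0 : ∀ u : ℝ, u ≤ 0 → K u = 0) (hε : ε = 1 ∨ ε = -1)
    {T : ℝ} (hT : 0 ≤ T) (hclean : ∀ s : ℝ, s ∈ Icc 0 T → NoUnitEigenvalue K s) :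
    ∃ M : ℝ, 0 ≤ M ∧ ∀ t : ℝ, t ∈ Icc 0 T → ∀ y : ℝ, y ∈ Icc (-t) t → |suzukiPhiExt K ε t y| ≤ M := by
  -- the resolvent applied to the right-hand side, as a continuous `L²(ℝ)`-valued map on `[0,T]`
  set Φ : ℝ → Lp ℝ 2 (volume : Measure ℝ) := fun t => Ring.inverse (1 + ε • winOpL2 K hK t)
    ((memLp_indicator_window (continuous_uncurry_kernel_shift hK) t).toLp _) with hΦ
  have hΦc : ContinuousOn Φ (Icc 0 T) := by
    intro t ht
    exact ((continuousWithinAt_inverse_winOpL2 hK hε ht.1 (hclean t ht)).clm_apply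
      ((continuousOn_toLp_indicator_window (continuous_uncurry_kernel_shift hK)) t ht.1)).mono fun s hs => hs.1
  obtain ⟨B, hB⟩ := (isCompact_Icc (a := (0:ℝ)) (b := T)).exists_bound_of_continuousOn hΦc
  have hB0 : 0 ≤ B := (norm_nonneg _).trans (hB 0 ⟨le_rfl, hT⟩)
  -- a bound for `K` on `[−2T, 2T]`
  obtain ⟨CK, hCK0, hCK⟩ := exists_bound_kernel_winSquare hK T
  refine ⟨CK + CK * Real.sqrt (2 * T) * B, by positivity, fun t ht y hy => ?_⟩
  rw [suzukiPhiExt_eq_inner hK hK0 hε (hclean t ht) y]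
  have hyt : |t| ≤ T := by rw [abs_of_nonneg ht.1]; exact ht.2
  have h1 : |K (y + t)| ≤ CK := hCK t hyt (y, t) (mem_prod.2 ⟨hy, ⟨by linarith [ht.1], le_rfl⟩⟩)
  have hrow : ‖(memLp_indicator_window (continuous_uncurry_kernel_row hK y) t).toLp _‖ ≤ CK * Real.sqrt (2 * t) :=
    norm_toLp_indicator_window_le (continuous_uncurry_kernel_row hK y) ht.1 hCK0
      (fun u hu => hCK t hyt (y, u) (mem_prod.2 ⟨hy, hu⟩))
  have h2 : |⟪(memLp_indicator_window (continuous_uncurry_kernel_row hK y) t).toLp _, Φ t⟫| ≤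
      CK * Real.sqrt (2 * T) * B := by
    refine (abs_real_inner_le_norm _ _).trans ?_
    have hst : Real.sqrt (2 * t) ≤ Real.sqrt (2 * T) := Real.sqrt_le_sqrt (by linarith [ht.2])
    calc ‖(memLp_indicator_window (continuous_uncurry_kernel_row hK y) t).toLp _‖ * ‖Φ t‖
        ≤ (CK * Real.sqrt (2 * t)) * B := mul_le_mul hrow (hB t ht) (norm_nonneg _) (by positivity)
      _ ≤ (CK * Real.sqrt (2 * T)) * B := by gcongr
  calc |K (y + t) - ε * ⟪(memLp_indicator_window (continuous_uncurry_kernel_row hK y) t).toLp _, Φ t⟫|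
      ≤ |K (y + t)| + |ε| * |⟪(memLp_indicator_window (continuous_uncurry_kernel_row hK y) t).toLp _, Φ t⟫| := by
        rw [← abs_mul]; exact abs_sub _ _
    _ ≤ CK + 1 * (CK * Real.sqrt (2 * T) * B) := by
        gcongr
        · rcases hε with rfl | rfl <;> simp
    _ = CK + CK * Real.sqrt (2 * T) * B := by ring

/-- **RH-FREE · UNIFORM DECAY OF `𝔉(t,·)`, `𝔊(t,·)` ON A COMPACT CLEAN RANGE:** for every `n` there is `C` with
`|frakFG ε (t,x)| ≤ C e^{−n|x|}` for all `0 ≤ t ≤ T` and all `x` (Prop. 3.1's decay with the constant uniform in `t`). -/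
theorem frakFG_decay_uniform (h : IsSuzukiPair ϱ K) (hε : ε = 1 ∨ ε = -1) {T : ℝ} (hT : 0 ≤ T)
    (hclean : ∀ s : ℝ, s ∈ Icc 0 T → NoUnitEigenvalue K s) (n : ℝ) :
    ∃ C : ℝ, ∀ t : ℝ, t ∈ Icc 0 T → ∀ x : ℝ, |frakFG ϱ K ε t x| ≤ C * Real.exp (-(n * |x|)) := by
  have hK3 : ∀ u : ℝ, u < 0 → K u = 0 := fun u hu => h.kernel_eq_zero u hu.le
  obtain ⟨M, hM0, hM⟩ := exists_bound_suzukiPhiExt_window h.continuous_kernel h.kernel_eq_zero hε hT hclean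
  obtain ⟨C, hC0, hC⟩ := decay_uniform_shift h.abs_rho_le n T
  set V : ℝ := (volume : Measure ℝ).real (Icc (-T) T) with hV
  have hV0 : 0 ≤ V := measureReal_nonneg
  refine ⟨1 / 2 * (C + |ε| * C) + |ε| / 2 * ((C + |ε| * C) * M * V), fun t ht x => ?_⟩
  have hsol : ∃ X : ℝ → ℝ, IsSuzukiPhiSolution K ε t X :=
    exists_isSuzukiPhiSolution_of_noUnitEigenvalue h.continuous_kernel h.kernel_eq_zero hε (hclean t ht)
  set φ := suzukiPhiExt K ε t with hφ
  rw [frakFG_eq_repr h hsol x, setIntegral_Iic_mul_suzukiPhiExt_eq_Icc hK3 _ ε t, ← hφ]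
  obtain ⟨hx1, hx2⟩ := hC x t (by rw [abs_of_nonneg ht.1]; exact ht.2)
  set ex : ℝ := Real.exp (-(n * |x|)) with hex
  have hex0 : 0 ≤ ex := (Real.exp_pos _).le
  have hVt : (volume : Measure ℝ).real (Icc (-t) t) ≤ V :=
    measureReal_mono (Icc_subset_Icc (by linarith [ht.2]) ht.2) measure_Icc_lt_top.ne
  have hint : ‖∫ y in Icc (-t) t, (ϱ (x - y) + ε * ϱ (-x - y)) * φ y‖ ≤ (C + |ε| * C) * ex * M * V := by
    refine (norm_setIntegral_le_of_norm_le_const (C := (C + |ε| * C) * ex * M)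
      (show (volume : Measure ℝ) (Icc (-t) t) < ∞ from measure_Icc_lt_top) fun y hy => ?_).trans ?_
    · have hyt : |y| ≤ T := (abs_le.2 ⟨by linarith [hy.1], hy.2⟩).trans ht.2
      obtain ⟨hy1, hy2⟩ := hC x y hyt
      have hφy : |φ y| ≤ M := hM t ht y hy
      rw [Real.norm_eq_abs, abs_mul]
      refine mul_le_mul ?_ hφy (abs_nonneg _) (by positivity)
      calc |ϱ (x - y) + ε * ϱ (-x - y)| ≤ |ϱ (x - y)| + |ε| * |ϱ (-x - y)| := by
            rw [← abs_mul]; exact abs_add_le _ _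
        _ ≤ C * ex + |ε| * (C * ex) := by gcongr
        _ = (C + |ε| * C) * ex := by ring
    · exact mul_le_mul_of_nonneg_left hVt (by positivity)
  rw [Real.norm_eq_abs] at hint
  calc |1 / 2 * (ϱ (x - t) + ε * ϱ (-x - t)) -
        ε / 2 * ∫ y in Icc (-t) t, (ϱ (x - y) + ε * ϱ (-x - y)) * φ y|
      ≤ |1 / 2 * (ϱ (x - t) + ε * ϱ (-x - t))| +
        |ε / 2 * ∫ y in Icc (-t) t, (ϱ (x - y) + ε * ϱ (-x - y)) * φ y| := abs_sub _ _
    _ = 1 / 2 * |ϱ (x - t) + ε * ϱ (-x - t)| +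
        |ε| / 2 * |∫ y in Icc (-t) t, (ϱ (x - y) + ε * ϱ (-x - y)) * φ y| := by
        rw [abs_mul, abs_mul, abs_div, abs_div, abs_one, abs_two]
    _ ≤ 1 / 2 * (C * ex + |ε| * (C * ex)) + |ε| / 2 * ((C + |ε| * C) * ex * M * V) := by
        gcongr
        calc |ϱ (x - t) + ε * ϱ (-x - t)| ≤ |ϱ (x - t)| + |ε * ϱ (-x - t)| := abs_add_le _ _
          _ = |ϱ (x - t)| + |ε| * |ϱ (-x - t)| := by rw [abs_mul]
          _ ≤ C * ex + |ε| * (C * ex) := by gcongr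
    _ = (1 / 2 * (C + |ε| * C) + |ε| / 2 * ((C + |ε| * C) * M * V)) * ex := by ring

/-- RH-FREE. **Continuity in `t` of the window integral in (3.28):** on a compact clean range `[0,T]`,
`t ↦ ∫_{[−t,t]} (ϱ(x−y) + εϱ(−x−y)) φ^ε(t,y) dy` is continuous (dominated convergence: uniform window bound, and
`t ↦ φ^ε(t,y)` continuous for every `y`). -/
theorem continuousOn_window_integral (h : IsSuzukiPair ϱ K) (hε : ε = 1 ∨ ε = -1) {T : ℝ} (hT : 0 ≤ T)
    (hclean : ∀ s : ℝ, s ∈ Icc 0 T → NoUnitEigenvalue K s) (x : ℝ) :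
    ContinuousOn (fun t : ℝ => ∫ y in Icc (-t) t, (ϱ (x - y) + ε * ϱ (-x - y)) * suzukiPhiExt K ε t y) (Icc 0 T) := by
  have hK3 : ∀ u : ℝ, u < 0 → K u = 0 := fun u hu => h.kernel_eq_zero u hu.le
  obtain ⟨M, hM0, hM⟩ := exists_bound_suzukiPhiExt_window h.continuous_kernel h.kernel_eq_zero hε hT hclean
  set w : ℝ → ℝ := fun y => ϱ (x - y) + ε * ϱ (-x - y) with hw
  have hwc : Continuous w := by
    have hρ := h.continuous_rho
    exact (hρ.comp (continuous_const.sub continuous_id)).add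
      (continuous_const.mul (hρ.comp (continuous_const.sub continuous_id)))
  obtain ⟨W, hW⟩ := (isCompact_Icc (a := -T) (b := T)).exists_bound_of_continuousOn hwc.continuousOn
  have hW0 : 0 ≤ W := (norm_nonneg _).trans (hW 0 ⟨by linarith, hT⟩)
  intro t₀ ht₀
  -- rewrite as integrals over `ℝ` with indicators
  have e : ∀ t : ℝ, ∫ y in Icc (-t) t, w y * suzukiPhiExt K ε t y =
      ∫ y, (Icc (-t) t).indicator (fun y => w y * suzukiPhiExt K ε t y) y := fun t =>
    (integral_indicator measurableSet_Icc).symm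
  show ContinuousWithinAt (fun t : ℝ => ∫ y in Icc (-t) t, w y * suzukiPhiExt K ε t y) (Icc 0 T) t₀
  simp_rw [e]
  refine tendsto_integral_filter_of_dominated_convergence (fun y => W * M * (Icc (-T) T).indicator (fun _ => (1:ℝ)) y)
    ?_ ?_ ?_ ?_
  · filter_upwards [self_mem_nhdsWithin] with t ht
    exact ((hwc.mul (continuous_suzukiPhiExt h.continuous_kernel hK3 ε t)).measurable.indicator
      measurableSet_Icc).aestronglyMeasurable
  · filter_upwards [self_mem_nhdsWithin] with t ht
    refine Eventually.of_forall fun y => ?_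
    by_cases hy : y ∈ Icc (-t) t
    · have hyT : y ∈ Icc (-T) T := ⟨by linarith [hy.1, ht.2], by linarith [hy.2, ht.2]⟩
      rw [indicator_of_mem hy, indicator_of_mem hyT, mul_one, Real.norm_eq_abs, abs_mul]
      have h1 := hW y hyT
      rw [Real.norm_eq_abs] at h1
      exact mul_le_mul h1 (hM t ht y hy) (abs_nonneg _) hW0
    · rw [indicator_of_notMem hy, norm_zero]
      exact mul_nonneg (mul_nonneg hW0 hM0) (Set.indicator_nonneg (fun _ _ => zero_le_one) _)
  · exact ((integrable_indicator_iff measurableSet_Icc).2 (integrableOn_const measure_Icc_lt_top.ne)).const_mul _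
  · -- pointwise convergence off `y = ±t₀`
    have hpts : ∀ᵐ y ∂(volume : Measure ℝ), y ≠ -t₀ ∧ y ≠ t₀ := by
      have h1 : ({-t₀}ᶜ : Set ℝ) ∈ ae (volume : Measure ℝ) := compl_mem_ae_iff.mpr (measure_singleton _)
      have h2 : ({t₀}ᶜ : Set ℝ) ∈ ae (volume : Measure ℝ) := compl_mem_ae_iff.mpr (measure_singleton _)
      filter_upwards [h1, h2] with y hy1 hy2
      exact ⟨hy1, hy2⟩
    filter_upwards [hpts] with y hy
    have hφy : Tendsto (fun t : ℝ => suzukiPhiExt K ε t y) (𝓝[Icc 0 T] t₀) (𝓝 (suzukiPhiExt K ε t₀ y)) :=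
      (continuousWithinAt_suzukiPhiExt_window h.continuous_kernel h.kernel_eq_zero hε ht₀.1 (hclean t₀ ht₀) y).mono
        fun s hs => ⟨hs.1, hclean s hs⟩
    rcases lt_or_gt_of_ne (show |y| ≠ t₀ from fun h' => by
      rcases abs_choice y with h'' | h''
      · exact hy.2 (by rw [← h', h''])
      · exact hy.1 (by rw [← h', h'']; ring)) with hlt | hgt
    · have hev : ∀ᶠ t in 𝓝[Icc 0 T] t₀, (Icc (-t) t).indicator (fun y => w y * suzukiPhiExt K ε t y) y =
          w y * suzukiPhiExt K ε t y := by
        filter_upwards [mem_nhdsWithin_of_mem_nhds (Ioi_mem_nhds hlt)] with t ht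
        have hyt : y ∈ Icc (-t) t := abs_le.1 (le_of_lt (show |y| < t from ht))
        rw [indicator_of_mem hyt]
      have hy0 : y ∈ Icc (-t₀) t₀ := abs_le.1 hlt.le
      rw [indicator_of_mem hy0]
      exact ((tendsto_const_nhds.mul hφy)).congr' (hev.mono fun t ht => ht.symm)
    · have hev : ∀ᶠ t in 𝓝[Icc 0 T] t₀, (Icc (-t) t).indicator (fun y => w y * suzukiPhiExt K ε t y) y = 0 := by
        filter_upwards [mem_nhdsWithin_of_mem_nhds (Iio_mem_nhds hgt)] with t ht
        have hyt : y ∉ Icc (-t) t := fun h' => (abs_le.2 h').not_gt (show t < |y| from ht)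
        rw [indicator_of_notMem hyt]
      have hy0 : y ∉ Icc (-t₀) t₀ := fun h' => (abs_le.2 h').not_gt hgt
      rw [indicator_of_notMem hy0]
      exact tendsto_const_nhds.congr' (hev.mono fun t ht => ht.symm)

/-- RH-FREE. **`t ↦ 𝔉(t,x)`, `𝔊(t,x)` are continuous on compact clean ranges** (for every `x`). -/
theorem continuousOn_frakFG (h : IsSuzukiPair ϱ K) (hε : ε = 1 ∨ ε = -1) {T : ℝ} (hT : 0 ≤ T)
    (hclean : ∀ s : ℝ, s ∈ Icc 0 T → NoUnitEigenvalue K s) (x : ℝ) :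
    ContinuousOn (fun t : ℝ => frakFG ϱ K ε t x) (Icc 0 T) := by
  have hK3 : ∀ u : ℝ, u < 0 → K u = 0 := fun u hu => h.kernel_eq_zero u hu.le
  have e : ∀ t ∈ Icc 0 T, frakFG ϱ K ε t x = 1 / 2 * (ϱ (x - t) + ε * ϱ (-x - t)) -
      ε / 2 * ∫ y in Icc (-t) t, (ϱ (x - y) + ε * ϱ (-x - y)) * suzukiPhiExt K ε t y := by
    intro t ht
    have hsol : ∃ X : ℝ → ℝ, IsSuzukiPhiSolution K ε t X :=
      exists_isSuzukiPhiSolution_of_noUnitEigenvalue h.continuous_kernel h.kernel_eq_zero hε (hclean t ht)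
    rw [frakFG_eq_repr h hsol x, setIntegral_Iic_mul_suzukiPhiExt_eq_Icc hK3 _ ε t]
  have hρ := h.continuous_rho
  have hP : Continuous fun t : ℝ => 1 / 2 * (ϱ (x - t) + ε * ϱ (-x - t)) :=
    continuous_const.mul ((hρ.comp (continuous_const.sub continuous_id)).add
      (continuous_const.mul (hρ.comp (continuous_const.sub continuous_id))))
  have hI := continuousOn_window_integral h hε hT hclean x
  exact (hP.continuousOn.sub (hI.const_smul (ε / 2) |>.congr fun t _ => by simp [smul_eq_mul])).congr e

/-- RH-FREE. **`t ↦ 𝖥(frakFG ε t)(z)` is continuous on compact clean ranges** (dominated convergence in `x` with the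
uniform decay). -/
theorem continuousOn_fourier_frakFG (h : IsSuzukiPair ϱ K) (hε : ε = 1 ∨ ε = -1) {T : ℝ} (hT : 0 ≤ T)
    (hclean : ∀ s : ℝ, s ∈ Icc 0 T → NoUnitEigenvalue K s) (z : ℂ) :
    ContinuousOn (fun t : ℝ => fourier (frakFG ϱ K ε t) z) (Icc 0 T) := by
  obtain ⟨C, hC⟩ := frakFG_decay_uniform h hε hT hclean (|z.im| + 1)
  intro t₀ ht₀
  show ContinuousWithinAt (fun t : ℝ => ∫ x : ℝ, (frakFG ϱ K ε t x : ℂ) * cexp (I * z * x)) (Icc 0 T) t₀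
  refine tendsto_integral_filter_of_dominated_convergence (fun x => C * Real.exp (-1 * |x|)) ?_ ?_ ?_ ?_
  · filter_upwards [self_mem_nhdsWithin] with t ht
    have hsol : ∃ X : ℝ → ℝ, IsSuzukiPhiSolution K ε t X :=
      exists_isSuzukiPhiSolution_of_noUnitEigenvalue h.continuous_kernel h.kernel_eq_zero hε (hclean t ht)
    exact (integrable_frakFG_mul_cexp h hsol z).aestronglyMeasurable
  · filter_upwards [self_mem_nhdsWithin] with t ht
    refine Eventually.of_forall fun x => ?_
    rw [norm_mul, Complex.norm_real, Real.norm_eq_abs]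
    calc |frakFG ϱ K ε t x| * ‖cexp (I * z * x)‖
        ≤ C * Real.exp (-((|z.im| + 1) * |x|)) * Real.exp (|z.im| * |x|) :=
          mul_le_mul (hC t ht x) (norm_cexp_I_mul_le z x) (norm_nonneg _) ((abs_nonneg _).trans (hC t ht x))
      _ = C * Real.exp (-1 * |x|) := by rw [mul_assoc, ← Real.exp_add]; congr 2; ring
  · exact (Literature.Analysis.Complex.integrable_exp_neg_mul_abs one_pos).const_mul C
  · refine Eventually.of_forall fun x => ?_
    have hc := continuousOn_frakFG h hε hT hclean x t₀ ht₀
    exact ((Complex.continuous_ofReal.continuousAt.comp_continuousWithinAt hc).mul tendsto_const_nhds)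

/-- **RH-FREE · THM. 3.1 (2), CONTINUITY: `t ↦ A(t,z)` is continuous on every clean range `[0,τ)`** (for every `z`). -/
theorem continuousOn_structA (h : IsSuzukiPair ϱ K) {τ : ℝ} (hclean : ∀ s : ℝ, s ∈ Ico 0 τ → NoUnitEigenvalue K s)
    (z : ℂ) : ContinuousOn (fun t : ℝ => structA ϱ K t z) (Ico 0 τ) := by
  intro t₀ ht₀
  set T : ℝ := (t₀ + τ) / 2 with hT
  have ht₀T : t₀ < T := by rw [hT]; linarith [ht₀.2]
  have hTτ : T < τ := by rw [hT]; linarith [ht₀.2]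
  have hT0 : 0 ≤ T := by linarith [ht₀.1]
  have hcleanT : ∀ s : ℝ, s ∈ Icc 0 T → NoUnitEigenvalue K s := fun s hs => hclean s ⟨hs.1, lt_of_le_of_lt hs.2 hTτ⟩
  have hnhds : Icc 0 T ∈ 𝓝[Ico 0 τ] t₀ :=
    mem_nhdsWithin.2 ⟨Iio T, isOpen_Iio, ht₀T, fun s hs => ⟨hs.2.1, le_of_lt hs.1⟩⟩
  have hm : ContinuousWithinAt (fun t : ℝ => (m K t : ℂ)) (Icc 0 T) t₀ :=
    Complex.continuous_ofReal.continuousAt.comp_continuousWithinAt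
      ((continuousOn_m_Ico h.continuous_kernel h.kernel_eq_zero hclean t₀ ht₀).mono fun s hs => ⟨hs.1, lt_of_le_of_lt hs.2 hTτ⟩)
  have hA : ContinuousWithinAt (fun t : ℝ => fourier (frakFG ϱ K 1 t) z) (Icc 0 T) t₀ :=
    continuousOn_fourier_frakFG h (Or.inl rfl) hT0 hcleanT z t₀ ⟨ht₀.1, ht₀T.le⟩
  exact ((hm.mul hA).mono_of_mem_nhdsWithin hnhds).congr (fun t _ => rfl) rfl

/-- **RH-FREE · THM. 3.1 (2), CONTINUITY: `t ↦ B(t,z)` is continuous on every clean range `[0,τ)`.** -/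
theorem continuousOn_structB (h : IsSuzukiPair ϱ K) {τ : ℝ} (hclean : ∀ s : ℝ, s ∈ Ico 0 τ → NoUnitEigenvalue K s)
    (z : ℂ) : ContinuousOn (fun t : ℝ => structB ϱ K t z) (Ico 0 τ) := by
  intro t₀ ht₀
  set T : ℝ := (t₀ + τ) / 2 with hT
  have ht₀T : t₀ < T := by rw [hT]; linarith [ht₀.2]
  have hTτ : T < τ := by rw [hT]; linarith [ht₀.2]
  have hT0 : 0 ≤ T := by linarith [ht₀.1]
  have hcleanT : ∀ s : ℝ, s ∈ Icc 0 T → NoUnitEigenvalue K s := fun s hs => hclean s ⟨hs.1, lt_of_le_of_lt hs.2 hTτ⟩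
  have hnhds : Icc 0 T ∈ 𝓝[Ico 0 τ] t₀ :=
    mem_nhdsWithin.2 ⟨Iio T, isOpen_Iio, ht₀T, fun s hs => ⟨hs.2.1, le_of_lt hs.1⟩⟩
  have hm : ContinuousWithinAt (fun t : ℝ => (((m K t)⁻¹ : ℝ) : ℂ)) (Icc 0 T) t₀ :=
    Complex.continuous_ofReal.continuousAt.comp_continuousWithinAt
      (((continuousOn_m_Ico h.continuous_kernel h.kernel_eq_zero hclean t₀ ht₀).mono
        fun s hs => ⟨hs.1, lt_of_le_of_lt hs.2 hTτ⟩).inv₀ (m_ne_zero K t₀))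
  have hB : ContinuousWithinAt (fun t : ℝ => I * fourier (frakFG ϱ K (-1) t) z) (Icc 0 T) t₀ :=
    (continuousOn_fourier_frakFG h (Or.inr rfl) hT0 hcleanT z t₀ ⟨ht₀.1, ht₀T.le⟩).const_smul I |>.congr
      (fun t _ => by simp [smul_eq_mul]) (by simp [smul_eq_mul])
  exact ((hm.mul hB).mono_of_mem_nhdsWithin hnhds).congr (fun t _ => rfl) rfl

/-- **RH-FREE · `t ↦ E(t,z)` is continuous on every clean range `[0,τ)`.** -/
theorem continuousOn_structE (h : IsSuzukiPair ϱ K) {τ : ℝ} (hclean : ∀ s : ℝ, s ∈ Ico 0 τ → NoUnitEigenvalue K s)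
    (z : ℂ) : ContinuousOn (fun t : ℝ => structE ϱ K t z) (Ico 0 τ) :=
  ((continuousOn_structA h hclean z).sub (continuousOn_const.mul (continuousOn_structB h hclean z))).congr
    fun _ _ => rfl

/-- **RH-FREE · THE CONTINUITY HALF OF THE DECLARED RESIDUAL, DISCHARGED:** under the hypotheses of
`Suzuki2021_thm31_dynamics` that concern continuity — a Suzuki pair `(ϱ, K)` and (K5) on `[0,τ)` — the structure
functions `A(t,z)`, `B(t,z)` are continuous in `t ∈ [0,τ)` for every `z`, and `m` is continuous on `[0,τ)` (the first two
conjuncts of the named fact; the third — piecewise `C¹` and the canonical system — remains open in the tree). -/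
theorem thm31_continuity (h : IsSuzukiPair ϱ K) {τ : ℝ} (hclean : ∀ s : ℝ, s ∈ Ico 0 τ → NoUnitEigenvalue K s) :
    (∀ z : ℂ, ContinuousOn (fun t : ℝ => structA ϱ K t z) (Ico 0 τ) ∧
        ContinuousOn (fun t : ℝ => structB ϱ K t z) (Ico 0 τ)) ∧
      ContinuousOn (m K) (Ico 0 τ) :=
  ⟨fun z => ⟨continuousOn_structA h hclean z, continuousOn_structB h hclean z⟩,
    continuousOn_m_Ico h.continuous_kernel h.kernel_eq_zero hclean⟩

end Summit.RiemannHypothesis.RiemannHypothesis.Theorems.SuzukiStructureFunctions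

end
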